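import Summits.QuantumFields.BalabanUV.T4Continuum.Support.NE7SliceLetterHodgeReduction
import Summits.QuantumFields.BalabanUV.T4Continuum.Support.NE7GaugeModeAllowance
import Summits.QuantumFields.BalabanUV.T4Continuum.Support.NE3ResidualSliceRep
import Summits.QuantumFields.BalabanUV.T4Continuum.Support.NE3EnergyHessBilin
import HarnessLib

/-!
# NE7SliceLetterHodgeReductionSplit — F137 WITH THE GAUGE PART PRICED BY TWO SEPARATE CONSTANTS: the generator's sup `‖ξ‖_∞ ≤ C_ξ·‖X‖_∞` (an ORDER −1 quantity, `C_ξ ≍ M`, no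
# logarithm expected) and the gauge mode's sup `‖gaugeDir W ξ‖_∞ ≤ C_H·‖X‖_∞` (an ORDER 0, Calderón–Zygmund-type quantity — `∇Δ⁻¹div` is NOT bounded on ℓ^∞ uniformly; `log M` risk);
# then (L2)ʰ on all tangent fields holds with `K_X′ = (1 + C_H)·K_X + 2(x + K_G·τ_W)·C_ξ` — the possibly-logarithmic `C_H` multiplies ONLY the (already small) slice constant `K_X`,
# while the curl and the functional contamination of the gauge part see only `C_ξ` (file 72 of the curved (APE))

Cell `pub-balaban`, rung (B)+1 sub-cell t4, lineage `b2b-balaban-t4-ne7-p1` (CRUX PROVER NE7 #1 = OWNER of row NE7), generation 80; memo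
`t4/b2b-balaban-t4-ne7-p1-g80/SLICE-LETTER-OBSTRUCTION.md` §8 (caution on ℓ^∞).  File F142, the proof of F137 `NE7SliceLetterHodgeReduction.sliceLetter_hom_of_hodge` with F132's
`‖ξ‖_∞ ≤ d(M−1)‖gaugeDir W ξ‖_∞` (which would route the order-0 constant into every term) replaced by a displayed order-(−1) hypothesis.
WHY.  Bałaban states his propagator bounds in sup AND Hölder norms ([Balaban1984PropagatorsII] Props. 2.2–2.6) because zeroth-order singular integrals (here: the gauge component
`gaugeDir W ξ = ∇_W Δ_W⁻¹ div_W X` of the slice Hodge decomposition) are not bounded on ℓ^∞ uniformly in the scale.  In F137 the constant `C_H` entered all three gauge costs through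
F132's Poincaré step; but two of them — the gauge mode's own curl `≤ 2x‖ξ‖_∞` and the functional contamination `≤ 2τ_W‖ξ‖_∞‖Y‖₁` — only need `‖ξ‖_∞ = ‖Δ_W⁻¹div_W X‖_∞`, an order −1
quantity (`≲ M‖X‖_∞`, level-free).  THIS file displays the two constants separately so that a logarithm in `C_H`, if it materialises, touches only `K_X·C_H`.
WHAT ([folklore]; 0 def, 0 sorry).  **`sliceLetter_hom_of_hodge_split`** — as F137 with (c₂) = `∃ ξ` skew periodic corner-vanishing, `X − gaugeDir W ξ ∈ S_L`, `‖ξ‖_∞ ≤ C_ξ·R`,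
`‖gaugeDir W ξ‖_∞ ≤ C_H·R`; conclusion `‖curlAt W X‖ ≤ K_G·g + ((1 + C_H)K_X + 2(x + K_G·τ_W)·C_ξ)·R`.
HONEST FRAMING (page 1): bookkeeping over DISPLAYED letters at one configuration; none of them proved or claimed; nothing of Bałaban's asserted; (APE) on curved data NOT proved; NOT
ONE-STEP, NOT NE7; spine 0∕9; finite T⁴ rung (B)+1 — NOT infinite volume, NOT mass gap, NOT `BetaPertH`, NOT Clay.  Continuum YM on T⁴ ⇐ BetaPertH ∧ nine spine estimates (0/9 proved);
BetaPertH ⇐ (D1) ∧ (D4) ∧ CAP+tail; G-an2-4 gates asym, D1 and NE2/3/4.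
-/

set_option autoImplicit false

open scoped BigOperators Matrix.Norms.L2Operator
open NormedSpace Finset

namespace Summit.QuantumFields.BalabanUV.T4Continuum.NE7SliceLetterHodgeReductionSplit

open Literature.MathematicalPhysics.QuantumFieldTheory.Balaban1983to89
open B7Prop1Explicit B7Prop2Explicit UnitaryModel
open T4AveragingDeficitWall (Ad IsUnitaryCfg IsSkewDir SmallField curlAt dirL1)
open T4AveragingDeficitWallBoundary (IsPeriodicCfg periodBox)
open AveragingDeficitPeriodicCounting (IsPeriodicDir)
open AveragingDeficitMultiLevelPrep (LevelSmall)
open MinimalActionLevels (perWin)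
open BlockAveragePushDirGauge (gaugeDir isPeriodicDir_gaugeDir)
open NE3HessForm (hess dAction)
open NE3TangentCovariantTower (dirIter)
open NE3ResidualSliceRep (dirIter_sub)
open NE3EnergyHessBilin (hess_add_left curlAt_add)
open NE3CurlOfGaugeDir (norm_curlAt_gaugeDir_le)
open NE7ExactCurrent (isSkewDir_gaugeDir)
open NE7HessGaugeDirLeftGeneral (hess_gaugeDir_left)
open NE7HessGaugeDirLeft (isSkewDir_commDir isPeriodicDir_commDir norm_commDir_le)
open NE7SliceLetterGaugeObstruction (dirIter_gaugeDir_eq_zero_of_vanish_corners)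
open NE7SliceLetterHodgeReduction (dirL1_commDir_le)

noncomputable section

variable {d : ℕ} {n : Type*} [Fintype n] [DecidableEq n]

/-! ## §2 The reduction -/

/-- **(L2)ʰ ON THE WHOLE TANGENT SLICE FROM (c₁) + (c₂) + THE TENSION LETTER.**  Data: `L ≥ 1`, `N`, `j` with `P = N·L^{j+1} ≥ 2`, `M = L^{j+1}`; `W` unitary `P`-periodic of the
multi-level class (`LevelSmall d L j x`, `SmallField W x`); the integrated tension letter `|dAction W K (perWin d P)| ≤ τ_W·‖K‖_{ℓ¹(periodBox P)}` for all skew `P`-periodic `K`;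
(c₁) the homogeneous two-term letter on a class `S_L` with constants `(K_G, K_X)`; (c₂) for every W-tangent skew `P`-periodic `X` a skew `P`-periodic `ξ` vanishing on
`Mℤ^d` with `X − gaugeDir W ξ ∈ S_L` and `‖gaugeDir W ξ‖_∞ ≤ C_H·R` whenever `‖X‖_∞ ≤ R`.  THEN for every W-tangent skew `P`-periodic `X`, every sup bound `R`, every
`g ≥ 0` bounding its slice functional: `‖curlAt W X z μ ν‖ ≤ K_G·g + ((1 + C_H)·K_X + 2d(M−1)·C_H·(x + K_G·τ_W))·R` on every plane `μ ≠ ν`. [folklore] -/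
theorem sliceLetter_hom_of_hodge_split [Nonempty n] {L N : ℕ} [NeZero N] (hL : 1 ≤ L) (j : ℕ) (hP : 2 ≤ N * L ^ (j + 1))
    {W : Site d → Fin d → (Matrix n n ℂ)ˣ} {x : ℝ} (hWu : IsUnitaryCfg W) (hWP : IsPeriodicCfg W ((N * L ^ (j + 1) : ℕ) : ℤ))
    (hx : 0 ≤ x) (hs : LevelSmall d L j x) (hWx : SmallField W x)
    {τW : ℝ} (hτ : 0 ≤ τW)
    (hten : ∀ K : Site d → Fin d → Matrix n n ℂ, IsSkewDir K → IsPeriodicDir K ((N * L ^ (j + 1) : ℕ) : ℤ) →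
      |dAction W K (perWin d (N * L ^ (j + 1)))| ≤ τW * dirL1 K (periodBox (d := d) (N * L ^ (j + 1))))
    (SL : Set (Site d → Fin d → Matrix n n ℂ)) {KG KX CH Cξ : ℝ}
    (hGL : ∀ X ∈ SL, IsPeriodicDir X ((N * L ^ (j + 1) : ℕ) : ℤ) → dirIter L (j + 1) W X = 0 → ∀ R : ℝ, (∀ y κ', ‖X y κ'‖ ≤ R) → ∀ g : ℝ, 0 ≤ g →
      (∀ Y : Site d → Fin d → Matrix n n ℂ, IsSkewDir Y → IsPeriodicDir Y ((N * L ^ (j + 1) : ℕ) : ℤ) → dirIter L (j + 1) W Y = 0 →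
        |hess W X Y (perWin d (N * L ^ (j + 1)))| ≤ g * dirL1 Y (periodBox (d := d) (N * L ^ (j + 1)))) →
      ∀ z μ' ν', μ' ≠ ν' → ‖curlAt W X z μ' ν'‖ ≤ KG * g + KX * R)
    (hHodge : ∀ X : Site d → Fin d → Matrix n n ℂ, IsSkewDir X → IsPeriodicDir X ((N * L ^ (j + 1) : ℕ) : ℤ) → dirIter L (j + 1) W X = 0 →
      ∃ ξ : Site d → Matrix n n ℂ, (∀ y, ξ y ∈ skewAdjoint (Matrix n n ℂ)) ∧
        (∀ (y : Site d) (i : Fin d), ξ (y + ((N * L ^ (j + 1) : ℕ) : ℤ) • e i) = ξ y) ∧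
        (∀ w : Site d, ξ (((L : ℤ) ^ (j + 1)) • w) = 0) ∧
        (fun y κ => X y κ - gaugeDir W ξ y κ) ∈ SL ∧
        (∀ R : ℝ, (∀ y κ', ‖X y κ'‖ ≤ R) → ∀ y : Site d, ‖ξ y‖ ≤ Cξ * R) ∧
        ∀ R : ℝ, (∀ y κ', ‖X y κ'‖ ≤ R) → ∀ (y : Site d) (κ : Fin d), ‖gaugeDir W ξ y κ‖ ≤ CH * R) :
    ∀ X : Site d → Fin d → Matrix n n ℂ, IsSkewDir X → IsPeriodicDir X ((N * L ^ (j + 1) : ℕ) : ℤ) → dirIter L (j + 1) W X = 0 →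
      ∀ R : ℝ, (∀ y κ', ‖X y κ'‖ ≤ R) → ∀ g : ℝ, 0 ≤ g →
      (∀ Y : Site d → Fin d → Matrix n n ℂ, IsSkewDir Y → IsPeriodicDir Y ((N * L ^ (j + 1) : ℕ) : ℤ) → dirIter L (j + 1) W Y = 0 →
        |hess W X Y (perWin d (N * L ^ (j + 1)))| ≤ g * dirL1 Y (periodBox (d := d) (N * L ^ (j + 1)))) →
      ∀ z μ' ν', μ' ≠ ν' → ‖curlAt W X z μ' ν'‖
        ≤ KG * g + ((1 + CH) * KX + 2 * (x + KG * τW) * Cξ) * R := by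
  intro X hXs hXP hXT R hR g hg hfun z μ' ν' hne
  have hR0 : 0 ≤ R := (norm_nonneg _).trans (hR z μ')
  -- (c₂): the decomposition
  obtain ⟨ξ, hξs, hξP, hξc, hXL, hCξ', hCH'⟩ := hHodge X hXs hXP hXT
  have hGsup : ∀ (y : Site d) (κ : Fin d), ‖gaugeDir W ξ y κ‖ ≤ CH * R := hCH' R hR
  have hΞ : ∀ y, ‖ξ y‖ ≤ Cξ * R := hCξ' R hR
  set Ξ : ℝ := Cξ * R with hΞdef
  have hΞ0 : 0 ≤ Ξ := (norm_nonneg _).trans (hΞ 0)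
  -- the two parts
  set G : Site d → Fin d → Matrix n n ℂ := gaugeDir W ξ with hGdef
  set XL : Site d → Fin d → Matrix n n ℂ := fun y κ => X y κ - G y κ with hXLdef
  have hGs : IsSkewDir G := isSkewDir_gaugeDir hWu hξs
  have hGP : IsPeriodicDir G ((N * L ^ (j + 1) : ℕ) : ℤ) := isPeriodicDir_gaugeDir hWP hξP
  have hGT : dirIter L (j + 1) W G = 0 := dirIter_gaugeDir_eq_zero_of_vanish_corners hL j hWu hWP hx hs hWx hξs hξP hξc
  have hXLP : IsPeriodicDir XL ((N * L ^ (j + 1) : ℕ) : ℤ) := fun y i κ => by simp only [hXLdef, hXP y i κ, hGP y i κ]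
  have hXLT : dirIter L (j + 1) W XL = 0 := by
    rw [hXLdef, dirIter_sub hL j hWu hx hs hWx X G, hXT, hGT]
    funext z' κ'
    simp
  have hXLsup : ∀ y κ', ‖XL y κ'‖ ≤ (1 + CH) * R := fun y κ' => by
    calc ‖XL y κ'‖ = ‖X y κ' - G y κ'‖ := rfl
      _ ≤ ‖X y κ'‖ + ‖G y κ'‖ := norm_sub_le _ _
      _ ≤ R + CH * R := add_le_add (hR y κ') (hGsup y κ')
      _ = (1 + CH) * R := by ring
  -- the slice functional of `XL`: that of `X` plus the gauge contamination
  have hfunL : ∀ Y : Site d → Fin d → Matrix n n ℂ, IsSkewDir Y → IsPeriodicDir Y ((N * L ^ (j + 1) : ℕ) : ℤ) → dirIter L (j + 1) W Y = 0 →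
      |hess W XL Y (perWin d (N * L ^ (j + 1)))| ≤ (g + 2 * τW * Ξ) * dirL1 Y (periodBox (d := d) (N * L ^ (j + 1))) := by
    intro Y hY hYP hYT
    have hsplit : X = XL + G := by funext y κ; simp [hXLdef]
    have hsum : hess W X Y (perWin d (N * L ^ (j + 1))) = hess W XL Y (perWin d (N * L ^ (j + 1))) + hess W G Y (perWin d (N * L ^ (j + 1))) := by
      rw [hsplit, hess_add_left]
    have hGhess : hess W G Y (perWin d (N * L ^ (j + 1)))
        = dAction W (fun y κ => Y y κ * ξ (y + e κ) - ξ (y + e κ) * Y y κ) (perWin d (N * L ^ (j + 1))) := by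
      rw [hGdef]; exact hess_gaugeDir_left hP W hξP Y _
    have hK := hten _ (isSkewDir_commDir hξs hY) (isPeriodicDir_commDir hξP hYP)
    have hK1 := dirL1_commDir_le ξ Y hΞ (periodBox (d := d) (N * L ^ (j + 1)))
    have hτ0 : 0 ≤ τW * dirL1 (fun y κ => Y y κ * ξ (y + e κ) - ξ (y + e κ) * Y y κ) (periodBox (d := d) (N * L ^ (j + 1))) :=
      (abs_nonneg _).trans hK
    have hfx := hfun Y hY hYP hYT
    have heq : hess W XL Y (perWin d (N * L ^ (j + 1))) = hess W X Y (perWin d (N * L ^ (j + 1))) - hess W G Y (perWin d (N * L ^ (j + 1))) := by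
      rw [hsum]; ring
    rw [heq]
    have hY1 : 0 ≤ dirL1 Y (periodBox (d := d) (N * L ^ (j + 1))) := by
      unfold T4AveragingDeficitWall.dirL1; exact Finset.sum_nonneg fun _ _ => Finset.sum_nonneg fun _ _ => norm_nonneg _
    have hGb : |hess W G Y (perWin d (N * L ^ (j + 1)))| ≤ 2 * τW * Ξ * dirL1 Y (periodBox (d := d) (N * L ^ (j + 1))) := by
      rw [hGhess]
      exact hK.trans ((mul_le_mul_of_nonneg_left hK1 hτ).trans (le_of_eq (by ring)))
    calc |hess W X Y (perWin d (N * L ^ (j + 1))) - hess W G Y (perWin d (N * L ^ (j + 1)))|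
        ≤ |hess W X Y (perWin d (N * L ^ (j + 1)))| + |hess W G Y (perWin d (N * L ^ (j + 1)))| := abs_sub _ _
      _ ≤ g * dirL1 Y (periodBox (d := d) (N * L ^ (j + 1))) + 2 * τW * Ξ * dirL1 Y (periodBox (d := d) (N * L ^ (j + 1))) := add_le_add hfx hGb
      _ = (g + 2 * τW * Ξ) * dirL1 Y (periodBox (d := d) (N * L ^ (j + 1))) := by ring
  -- (c₁) on `XL`, the gauge part's own curl (F132-type), and the sum
  have hgL0 : 0 ≤ g + 2 * τW * Ξ := by positivity
  have hcurlL : ‖curlAt W XL z μ' ν'‖ ≤ KG * (g + 2 * τW * Ξ) + KX * ((1 + CH) * R) :=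
    hGL XL hXL hXLP hXLT ((1 + CH) * R) hXLsup (g + 2 * τW * Ξ) hgL0 hfunL z μ' ν' hne
  have hcurlG : ‖curlAt W G z μ' ν'‖ ≤ 2 * x * Ξ := by
    have h := norm_curlAt_gaugeDir_le hWu hWx ξ z hne
    rw [hGdef]
    exact h.trans (mul_le_mul_of_nonneg_left (hΞ z) (by positivity))
  have hsplit : X = XL + G := by funext y κ; simp [hXLdef]
  have hcurlX : curlAt W X z μ' ν' = curlAt W XL z μ' ν' + curlAt W G z μ' ν' := by rw [hsplit, curlAt_add]
  rw [hcurlX]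
  calc ‖curlAt W XL z μ' ν' + curlAt W G z μ' ν'‖ ≤ ‖curlAt W XL z μ' ν'‖ + ‖curlAt W G z μ' ν'‖ := norm_add_le _ _
    _ ≤ KG * (g + 2 * τW * Ξ) + KX * ((1 + CH) * R) + 2 * x * Ξ := add_le_add hcurlL hcurlG
    _ = KG * g + ((1 + CH) * KX + 2 * (x + KG * τW) * Cξ) * R := by
        rw [hΞdef]; ring

end

end Summit.QuantumFields.BalabanUV.T4Continuum.NE7SliceLetterHodgeReductionSplit
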